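import Summits.CriticalPhenomena.Ising3DConformalLimit.Theses.TauBallRounding
import Literature.Probability.LatticeModels.DirInvCorrLength

/-!
# Birth skeleton for crux `RoundEndpoint` (stmt-CriticalPhenomena-4808) — "the τ-ball ends as the sphere"

Route `TauBallRounding` (Ising3DConformalLimit), crux (T2), rank 3:
`RoundEndpoint := MonotoneRounding → ∃ τ (directional rate of ⟨σ₀σ_{nx}⟩⁺_β on (0,β_c(3)) × ℤ³),
  ∀ x ≠ 0, τ β x / (τ β e₁ · ‖x‖₂) → 1 as β ↑ β_c(3)`.

The witness `τ` is fixed once and for all: the directional inverse correlation length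
`ξ_β(x) := Literature.Probability.LatticeModels.dirInvCorrLength 3 β x` (Fekete limit, `tendsto_dirInvCorrLength`;
this is the proved support item `RateExistsPositive`, stmt-4810). Write `e₁ := Pi.single 0 1`,
`‖x‖₂ := √(∑ᵢ xᵢ²)` and `A_β(x) := ξ_β(x) / (ξ_β(e₁) ‖x‖₂)` (the axis-normalised anisotropy ratio; the rigorous
Messager–Miracle-Solé window is `‖x‖_∞/‖x‖₂ ≤ A_β(x) ≤ ‖x‖₁/‖x‖₂`, `supNorm_mul_dirInvCorrLength_axis_le`,
`dirInvCorrLength_le_l1Norm_mul_axis`).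

LINE (the route header's own two-layer plan for this node, "RoundEndpoint ⇐ [AxisSlowest] → [limsup ≤ 1 along one
sequence β_k ↑ β_c] → RoundEndpoint", made into a checked skeleton):

* `stub_axisSlowest` — AXIS SLOWEST / the ξ-ball sits inside the Euclidean ball of its axis radius:
  `ξ_β(e₁) ‖x‖₂ ≤ ξ_β(x)` for all `0 < β < β_c(3)` and all `x ∈ ℤ³`, i.e. `A_β(x) ≥ 1` (the liminf half of the
  endpoint). A fixed-β correlation-inequality statement; known only with `‖x‖_∞` in place of `‖x‖₂` (MMS).
  Evidence: `β → 0⁺` (`A → ‖x‖₁/‖x‖₂ ≥ 1`), the free lattice field (`A − 1 ≍ +m²`), the solved square lattice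
  (`A₂ ≥ 1`, item PlanarExactRounding, proved), CPRV numerics. OPEN.
* `stub_roundAlongSequence` — ROUNDING ALONG A SEQUENCE / the limsup half along SOME temperatures: for every
  `x ≠ 0`, `ε > 0` and `β₀ < β_c(3)` there is `β ∈ (β₀, β_c(3))` with `ξ_β(x) ≤ (1+ε) ξ_β(e₁) ‖x‖₂`, i.e.
  `liminf_{β↑β_c} A_β(x) ≤ 1` direction by direction. This is where the near-critical isotropy lives (CPRV's
  restoration `A − 1 ∼ ξ^{-ρ}`, `ρ ≈ 2`), but only subsequentially and only as an upper bound. OPEN (the heart).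
* `roundEndpoint_of_axisSlowest_roundAlongSequence` (hypothesis form, sorry-free, standard axioms) and
  `RoundEndpoint_of` (the two declared stubs fed in; concludes the crux BY NAME) — the composition, a REAL proof
  that USES the crux's own hypothesis `MonotoneRounding` (T1): T1 makes `β ↦ A_β(x)` antitone on `(0, β_c)`, so
  "`A ≤ 1+ε` at one `β₁ < β_c`" upgrades to "`A ≤ 1+ε` on `[β₁, β_c)`"; with `A ≥ 1` from `stub_axisSlowest` the
  order-topology squeeze gives `A_β(x) → 1` along `𝓝[<] β_c(3)`. Positivity `ξ_β(e₁) > 0` on `(0, β_c)` is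
  Aizenman–Barsky–Fernández sharpness (`dirInvCorrLength_pos`).

Why this is not the crux in costume: neither stub controls the limit — `stub_axisSlowest` is a one-sided bound at
each fixed `β` (no `β ↑ β_c` content), `stub_roundAlongSequence` is one-sided and subsequential (without T1 the ratio
could oscillate in `[1, √3]`); the crux's value `1` appears only after T1's monotonicity is spent in the composition.
-/

namespace Summit.CriticalPhenomena.Ising3DConformalLimit.Cruxes.RoundEndpoint.Birth

open Filter Topology
open Literature.Probability.LatticeModels
open Summit.CriticalPhenomena.Ising3DConformalLimit.Theses.TauBallRounding

/-- **stub_axisSlowest** (OPEN; "the axis is the slowest direction per unit Euclidean length", the liminf half):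
for `0 < β < β_c(3)` and every `x ∈ ℤ³`, `ξ_β(e₁) · ‖x‖₂ ≤ ξ_β(x)` — the `ξ_β`-unit ball, rescaled by its axis
radius, lies inside the Euclidean unit ball (touching it at `±eᵢ`). Known: the same with `‖x‖_∞`
(Messager–Miracle-Solé, `supNorm_mul_dirInvCorrLength_axis_le`). -/
theorem stub_axisSlowest :
    ∀ β : ℝ, 0 < β → β < criticalBeta 3 → ∀ x : Site 3,
      dirInvCorrLength 3 β (Pi.single 0 1) * Real.sqrt (∑ i, ((x i : ℝ)) ^ 2) ≤
        dirInvCorrLength 3 β x := by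
  sorry

/-- **stub_roundAlongSequence** (OPEN, the heart; "the mass shell is round along some sequence `β_k ↑ β_c`",
the limsup half, subsequential and one-sided): for every `x ≠ 0`, `ε > 0` and `β₀ < β_c(3)` there is
`β ∈ (β₀, β_c(3))` with `ξ_β(x) ≤ (1 + ε) · ξ_β(e₁) · ‖x‖₂`. -/
theorem stub_roundAlongSequence :
    ∀ x : Site 3, x ≠ 0 → ∀ ε : ℝ, 0 < ε → ∀ β₀ : ℝ, β₀ < criticalBeta 3 →
      ∃ β : ℝ, β₀ < β ∧ β < criticalBeta 3 ∧
        dirInvCorrLength 3 β x ≤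
          (1 + ε) * (dirInvCorrLength 3 β (Pi.single 0 1) * Real.sqrt (∑ i, ((x i : ℝ)) ^ 2)) := by
  sorry

/-- **Composition, hypothesis form** (sorry-free, standard axioms):
`(statement of stub_axisSlowest) → (statement of stub_roundAlongSequence) → (definiens of RoundEndpoint)`,
with the witness `τ := dirInvCorrLength 3`. The crux hypothesis `MonotoneRounding` is load-bearing: it turns
the subsequential upper bound into an eventual one. -/
theorem roundEndpoint_of_axisSlowest_roundAlongSequence
    (hA : ∀ β : ℝ, 0 < β → β < criticalBeta 3 → ∀ x : Site 3,
      dirInvCorrLength 3 β (Pi.single 0 1) * Real.sqrt (∑ i, ((x i : ℝ)) ^ 2) ≤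
        dirInvCorrLength 3 β x)
    (hB : ∀ x : Site 3, x ≠ 0 → ∀ ε : ℝ, 0 < ε → ∀ β₀ : ℝ, β₀ < criticalBeta 3 →
      ∃ β : ℝ, β₀ < β ∧ β < criticalBeta 3 ∧
        dirInvCorrLength 3 β x ≤
          (1 + ε) * (dirInvCorrLength 3 β (Pi.single 0 1) * Real.sqrt (∑ i, ((x i : ℝ)) ^ 2))) :
    MonotoneRounding →
      ∃ τ : ℝ → Site 3 → ℝ,
        (∀ (β : ℝ) (x : Site 3), 0 < β → β < criticalBeta 3 →
          Tendsto (fun n : ℕ => -Real.log (twoPointPlus 3 β ((n : ℤ) • x)) / (n : ℝ)) atTop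
            (𝓝 (τ β x))) ∧
        ∀ x : Site 3, x ≠ 0 →
          Tendsto (fun β : ℝ => τ β x / (τ β (Pi.single 0 1) * Real.sqrt (∑ i, ((x i : ℝ)) ^ 2)))
            (𝓝[<] criticalBeta 3) (𝓝 1) := by
  intro hT1
  -- the witness: the directional inverse correlation length (Fekete limit, RateExistsPositive)
  have hrate : ∀ (β : ℝ) (x : Site 3), 0 < β → β < criticalBeta 3 →
      Tendsto (fun n : ℕ => -Real.log (twoPointPlus 3 β ((n : ℤ) • x)) / (n : ℝ)) atTop
        (𝓝 (dirInvCorrLength 3 β x)) :=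
    fun β x hβ _ => tendsto_dirInvCorrLength hβ x
  refine ⟨dirInvCorrLength 3, hrate, fun x hx => ?_⟩
  -- constants: β_c(3) > 0, e₁ ≠ 0, ‖x‖₂ > 0, ξ_β(e₁) > 0 on (0, β_c)
  have hβc : 0 < criticalBeta 3 := criticalBeta_pos_holds (d := 3) (by norm_num)
  have he₁ : (Pi.single 0 1 : Site 3) ≠ 0 := by
    intro h
    have h0 := congrFun h 0
    simp at h0
  have hN0 : 0 < Real.sqrt (∑ i, ((x i : ℝ)) ^ 2) := by
    obtain ⟨i, hi⟩ := Function.ne_iff.1 hx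
    have hi0 : x i ≠ 0 := by simpa using hi
    have hi' : ((x i : ℝ)) ≠ 0 := Int.cast_ne_zero.2 hi0
    have hsq : 0 < ((x i : ℝ)) ^ 2 := lt_of_le_of_ne (sq_nonneg _) (pow_ne_zero 2 hi').symm
    have hle : ((x i : ℝ)) ^ 2 ≤ ∑ j, ((x j : ℝ)) ^ 2 :=
      Finset.single_le_sum (f := fun j => ((x j : ℝ)) ^ 2) (fun j _ => sq_nonneg _) (Finset.mem_univ i)
    exact Real.sqrt_pos.2 (hsq.trans_le hle)
  have hpos : ∀ β : ℝ, 0 < β → β < criticalBeta 3 → 0 < dirInvCorrLength 3 β (Pi.single 0 1) :=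
    fun β hβ hβc' => dirInvCorrLength_pos (d := 3) (by norm_num) hβ hβc' he₁
  -- (T1): the axis-normalised ratio is antitone on (0, β_c)
  have hanti : AntitoneOn (fun β : ℝ => dirInvCorrLength 3 β x / dirInvCorrLength 3 β (Pi.single 0 1))
      (Set.Ioo 0 (criticalBeta 3)) := hT1 (dirInvCorrLength 3) hrate x hx
  have hanti' : ∀ β β' : ℝ, 0 < β → β ≤ β' → β' < criticalBeta 3 →
      dirInvCorrLength 3 β' x / (dirInvCorrLength 3 β' (Pi.single 0 1) * Real.sqrt (∑ i, ((x i : ℝ)) ^ 2)) ≤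
        dirInvCorrLength 3 β x / (dirInvCorrLength 3 β (Pi.single 0 1) * Real.sqrt (∑ i, ((x i : ℝ)) ^ 2)) := by
    intro β β' hβ hle hβ'c
    have h := hanti ⟨hβ, hle.trans_lt hβ'c⟩ ⟨hβ.trans_le hle, hβ'c⟩ hle
    simp only at h
    rw [← div_div, ← div_div]
    exact div_le_div_of_nonneg_right h hN0.le
  -- liminf half: the ratio is ≥ 1 on (0, β_c) (stub_axisSlowest)
  have hlow : ∀ β : ℝ, 0 < β → β < criticalBeta 3 →
      1 ≤ dirInvCorrLength 3 β x / (dirInvCorrLength 3 β (Pi.single 0 1) * Real.sqrt (∑ i, ((x i : ℝ)) ^ 2)) := by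
    intro β hβ hβc'
    rw [le_div_iff₀ (mul_pos (hpos β hβ hβc') hN0), one_mul]
    exact hA β hβ hβc' x
  -- order-topology squeeze along 𝓝[<] β_c
  refine tendsto_order.2 ⟨fun a ha => ?_, fun b hb => ?_⟩
  · filter_upwards [Ioo_mem_nhdsLT hβc] with β hβ
    exact ha.trans_le (hlow β hβ.1 hβ.2)
  · -- limsup half: ≤ 1 + ε at one β₁ ∈ (β_c/2, β_c) (stub_roundAlongSequence), then on [β₁, β_c) by (T1)
    obtain ⟨β₁, hβ₁l, hβ₁c, hβ₁r⟩ :=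
      hB x hx ((b - 1) / 2) (by linarith) (criticalBeta 3 / 2) (by linarith)
    have hβ₁pos : 0 < β₁ := by linarith
    have hr₁ : dirInvCorrLength 3 β₁ x /
        (dirInvCorrLength 3 β₁ (Pi.single 0 1) * Real.sqrt (∑ i, ((x i : ℝ)) ^ 2)) ≤ 1 + (b - 1) / 2 := by
      rw [div_le_iff₀ (mul_pos (hpos β₁ hβ₁pos hβ₁c) hN0)]
      exact hβ₁r
    filter_upwards [Ico_mem_nhdsLT hβ₁c] with β hβ
    have h := (hanti' β₁ β hβ₁pos hβ.1 hβ.2).trans hr₁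
    linarith

/-- **Skeleton theorem (the composition BY NAME).** The crux `RoundEndpoint` of route `TauBallRounding` from the
two declared stubs `stub_axisSlowest` and `stub_roundAlongSequence`, through the sorry-free
`roundEndpoint_of_axisSlowest_roundAlongSequence`. -/
theorem RoundEndpoint_of :
    Summit.CriticalPhenomena.Ising3DConformalLimit.Theses.TauBallRounding.RoundEndpoint :=
  roundEndpoint_of_axisSlowest_roundAlongSequence stub_axisSlowest stub_roundAlongSequence

end Summit.CriticalPhenomena.Ising3DConformalLimit.Cruxes.RoundEndpoint.Birth
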